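import Mathlib
import HarnessLib
import Literature.MathematicalPhysics.QuantumLattice.HubbardHighTemperatureMomentum
import Literature.MathematicalPhysics.QuantumLattice.MatsubaraSectorPropagator
import Literature.MathematicalPhysics.QuantumLattice.HubbardFermiCurve

/-!
# Route `KLProgramme` — definitions `ThermalTwoPointMomentum`: the imaginary-time and Matsubara–momentum thermal two-point
# function of the Hubbard torus, its thermodynamic limit, and the FERMI-LIQUID-FORM predicate of H1.i-b

Definition item `defn-HubbardThermalTwoPointMomentum` of the cell `gate-hubbard-kl` (planner-g4/D-items.md D1; wanted by crux
`KLRegimeTwoPointLimit` = stmt-HubbardSuperconductivity-19937): the vocabulary in which the Fermi-liquid FORM of the limit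
two-point function (survey §1 (a)(i): "the two-point function has BGM's Fermi-liquid form"; Salmhofer's `T > 0` criterion,
CMP 194 (1998) Definition 1 — typed abstractly over `GreenFunctionData` in `FermiRG/Salmhofer1998Sec2.lean`) can be stated
for the CONCRETE carrier `hubbardTorusWith 2 L 1 U μ` as a strengthening (H1.i-b) of the landed leaf `H1TwoPointLimitKLScaleD`
(which only asserts that the equal-time limit exists).  Cell ruling W-004: consumers bind carriers — this file is that binding:

* `hubbardThermalTwoPointTime β U μ L τ x y σ σ'` — the **imaginary-time two-point function**
  `⟨c†_{xσ}(τ) c_{yσ'}(0)⟩_{β,L} = Z⁻¹ Tr(e^{-(β-τ)H} c†_{xσ} e^{-τH} c_{yσ'})`, `H = hubbardTorusWith 2 L 1 U μ`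
  (BGM 2006 (1.3): `S(x,y) = ⟨T ψ⁺_x ψ⁻_y⟩`, `ψ^±_x = e^{x₀H} ψ^± e^{-x₀H}`, at `x₀ - y₀ = τ ∈ [0, β]`); at `τ = 0` it IS the
  tree's equal-time `hubbardThermalTwoPoint` (`hubbardThermalTwoPointTime_zero`, PROVED);
* `hubbardTwoPointTimeLimit β U μ τ z σ σ'` — its `L → ∞` limit `S(τ, z) = lim_L ⟨c†_{0σ}(τ) c_{zσ'}⟩` as a `limUnder` (the
  convention of the tree's `htTwoPointLimit`), with the existence predicate `HubbardTwoPointTimeConverges` separate;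
* `hubbardTwoPointHat β U μ n p σ σ'` — the **momentum–Matsubara two-point function of the infinite system**:
  `Ŝ(k₀, p) = Σ_{z ∈ ℤ²} e^{i p·z} ∫₀^β e^{-i k₀ τ} S(τ, z) dτ` at the fermionic frequency `k₀ = fermiMatsubara β n = (2n+1)π/β`
  (`tsum`, junk `0` if not summable — predicate `HubbardTwoPointHatSummable`; phase convention of the tree's
  `htMomentumDist`); with these signs the FREE function is `Ŝ₀(k₀, p) = 1/(i k₀ - e_μ(p))`, `e_μ(p) = ε(p) - μ`
  (`freeTwoPointHat`; one mode: `∫₀^β e^{-ik₀τ} e^{τe} n_F(e) dτ = 1/(ik₀ - e)` since `e^{-ik₀β} = -1`);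
* `HubbardTwoPointMomentumLimitExists β U μ` — (b) of the item: all imaginary-time limits exist and the Fourier series
  converge absolutely;
* `IsFermiLiquidForm β U μ C α` — (c) of the item, **the Fermi-liquid form at `T > 0`**: there is a self-energy
  `Σ : ℤ → ℝ² → ℂ` with `|Σ| ≤ CU`, `|Σ(k₀,p) - Σ(k₀,p')| ≤ CU‖p - p'‖`, `|Σ(k₀,p) - Σ(k₀',p)| ≤ CU|k₀ - k₀'|^α`, such that
  `Ŝ_{σσ'}(k₀,p) = δ_{σσ'} / (i k₀ - e_μ(p) - Σ(k₀,p))` for all `n, p` (D-items D1 (c) verbatim; `C, α` are for the consumer to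
  quantify uniformly in `β`).

Design: finite `(β, L)` objects with junk `0` at `L = 0` as `hubbardThermalTwoPoint`; the formula for `τ ∉ [0, β]` is the same
expression (no KMS extension is claimed); limits as `limUnder` + predicates; `p ∈ ℝ²` as `Fin 2 → ℝ` with `kdotSite`,
`sqDispersion` (`= -2(cos p₀ + cos p₁)`).  Nothing is asserted about the Hubbard model.

References: G. Benfatto, A. Giuliani, V. Mastropietro, Ann. Henri Poincaré 7 (2006) 809, §1 (1.3)–(1.6) (Schwinger functions,
Fermi-liquid form of the two-point function); M. Salmhofer, Commun. Math. Phys. 194 (1998) 249, §2.6 Definition 1; cell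
gate-hubbard-kl planner-g4/D-items.md D1.
-/

noncomputable section

namespace Summit.HubbardSuperconductivity.HubbardSuperconductivity.Theorems.KLProgrammeTwoPoint

set_option linter.dupNamespace false -- summit = problem name (single-conjunct summit), D-0017

open Filter Topology Matrix
open Literature.MathematicalPhysics.QuantumLattice Literature.Probability.LatticeModels

/-! ### Finite volume: the imaginary-time two-point function -/

/-- **The imaginary-time thermal two-point function** of the 2D Hubbard torus (hopping `1`, interaction `U`, chemical
potential `μ`, side `L`): `⟨c†_{xσ}(τ) c_{yσ'}(0)⟩_{β,L} = Z⁻¹ Tr(e^{-(β-τ)H} c†_{xσ} e^{-τH} c_{yσ'})` for `τ ∈ [0, β]`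
(lattice sites `x, y ∈ ℤ²` projected to the torus; junk `0` for `L = 0`). [cite: BenfattoGiulianiMastropietro2006, §1 (1.3)] -/
def hubbardThermalTwoPointTime (β U μ : ℝ) (L : ℕ) (τ : ℝ) (x y : Site 2) (σ σ' : Fin 2) : ℂ :=
  if hL : L = 0 then 0
  else
    haveI : NeZero L := ⟨hL⟩
    (partitionFn β (hubbardTorusWith 2 L 1 U μ))⁻¹ *
      (gibbsWeight (β - τ) (hubbardTorusWith 2 L 1 U μ) *
            creation (orb (FermionTorus.ofTorusSite (Torus.proj L x)) σ) *
          gibbsWeight τ (hubbardTorusWith 2 L 1 U μ) *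
            annihilation (orb (FermionTorus.ofTorusSite (Torus.proj L y)) σ')).trace

/-- **At `τ = 0` it is the tree's equal-time two-point function** `hubbardThermalTwoPoint`. [folklore] -/
theorem hubbardThermalTwoPointTime_zero (β U μ : ℝ) (L : ℕ) (x y : Site 2) (σ σ' : Fin 2) :
    hubbardThermalTwoPointTime β U μ L 0 x y σ σ' = hubbardThermalTwoPoint β U μ L x y σ σ' := by
  unfold hubbardThermalTwoPointTime hubbardThermalTwoPoint
  split_ifs with hL
  · rfl
  · rw [sub_zero, gibbsWeight_zero, mul_one, thermalCorr, gibbsState_apply, mul_assoc]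

/-! ### The thermodynamic limit in position space -/

/-- The imaginary-time two-point functions converge as `L → ∞` (existence predicate). [folklore] -/
def HubbardTwoPointTimeConverges (β U μ : ℝ) (τ : ℝ) (z : Site 2) (σ σ' : Fin 2) : Prop :=
  ∃ S : ℂ, Tendsto (fun L : ℕ => hubbardThermalTwoPointTime β U μ L τ 0 z σ σ') atTop (𝓝 S)

/-- **The infinite-volume imaginary-time two-point function** `S(τ, z) = lim_{L→∞} ⟨c†_{0σ}(τ) c_{zσ'}(0)⟩_{β,L}` (`limUnder`,
the convention of `htTwoPointLimit`; meaningful under `HubbardTwoPointTimeConverges`).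
[cite: BenfattoGiulianiMastropietro2006, §1 (1.4)] -/
def hubbardTwoPointTimeLimit (β U μ : ℝ) (τ : ℝ) (z : Site 2) (σ σ' : Fin 2) : ℂ :=
  limUnder atTop fun L : ℕ => hubbardThermalTwoPointTime β U μ L τ 0 z σ σ'

/-! ### Momentum–Matsubara space -/

/-- The Matsubara–Fourier coefficient at site `z`: `∫₀^β e^{-i k₀ τ} S(τ, z) dτ`, `k₀ = fermiMatsubara β n = (2n+1)π/β`.
[cite: BenfattoGiulianiMastropietro2006, §1 (1.5)] -/
def hubbardTwoPointMatsubara (β U μ : ℝ) (n : ℤ) (z : Site 2) (σ σ' : Fin 2) : ℂ :=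
  ∫ τ in (0 : ℝ)..β, Complex.exp (-((fermiMatsubara β n * τ : ℝ) : ℂ) * Complex.I) *
    hubbardTwoPointTimeLimit β U μ τ z σ σ'

/-- The spatial Fourier series converges absolutely (predicate). [folklore] -/
def HubbardTwoPointHatSummable (β U μ : ℝ) (n : ℤ) (σ σ' : Fin 2) : Prop :=
  Summable fun z : Site 2 => ‖hubbardTwoPointMatsubara β U μ n z σ σ'‖

/-- **The momentum–Matsubara two-point function of the infinite system**
`Ŝ_{σσ'}(k₀, p) = Σ_{z ∈ ℤ²} e^{i p·z} ∫₀^β e^{-i k₀ τ} S(τ, z) dτ`, `k₀ = (2n+1)π/β`, `p ∈ ℝ²` (`tsum`; junk `0` if the series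
does not converge).  With these signs the free function is `1/(ik₀ - e_μ(p))`. [cite: BenfattoGiulianiMastropietro2006, §1 (1.5)–(1.6)] -/
def hubbardTwoPointHat (β U μ : ℝ) (n : ℤ) (p : Fin 2 → ℝ) (σ σ' : Fin 2) : ℂ :=
  ∑' z : Site 2, Complex.exp (((kdotSite p z : ℝ) : ℂ) * Complex.I) * hubbardTwoPointMatsubara β U μ n z σ σ'

/-- **(b) The momentum-space thermodynamic limit exists**: every imaginary-time two-point function converges as `L → ∞`
(`τ ∈ [0, β]`, all sites and spins) and every Matsubara–Fourier series converges absolutely. [folklore] -/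
def HubbardTwoPointMomentumLimitExists (β U μ : ℝ) : Prop :=
  (∀ τ ∈ Set.Icc (0 : ℝ) β, ∀ (z : Site 2) (σ σ' : Fin 2), HubbardTwoPointTimeConverges β U μ τ z σ σ') ∧
    ∀ (n : ℤ) (σ σ' : Fin 2), HubbardTwoPointHatSummable β U μ n σ σ'

/-- The renormalised free band `e_μ(p) = ε(p) - μ = -2(cos p₀ + cos p₁) - μ`. [folklore] -/
def freeBand (μ : ℝ) (p : Fin 2 → ℝ) : ℝ := sqDispersion p - μ

/-- The free momentum–Matsubara two-point function `Ŝ₀(k₀, p) = 1/(i k₀ - e_μ(p))` in the sign conventions of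
`hubbardTwoPointHat`. [cite: BenfattoGiulianiMastropietro2006, §1 (1.6)] -/
def freeTwoPointHat (β μ : ℝ) (n : ℤ) (p : Fin 2 → ℝ) : ℂ :=
  1 / (((fermiMatsubara β n : ℝ) : ℂ) * Complex.I - ((freeBand μ p : ℝ) : ℂ))

/-! ### (c) The Fermi-liquid form at `T > 0` -/

/-- **The self-energy bounds of the Fermi-liquid form** for `Σ : ℤ → ℝ² → ℂ` (Matsubara index, momentum): size `|Σ| ≤ CU`,
Lipschitz in the momentum `|Σ(k₀,p) - Σ(k₀,p')| ≤ CU‖p - p'‖`, Hölder-`α` in the frequency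
`|Σ(k₀,p) - Σ(k₀',p)| ≤ CU|k₀ - k₀'|^α` (D-items D1 (c); Salmhofer 1998 Definition 1 measures `C²` regularity of the SKELETON
self-energy instead — the abstract predicate `FermiRG.Salmhofer1998.IsFermiLiquid`). [cite: Salmhofer1998, §2.6 Definition 1] -/
def SelfEnergyBounds (β U C α : ℝ) (Sig : ℤ → (Fin 2 → ℝ) → ℂ) : Prop :=
  (∀ (n : ℤ) (p : Fin 2 → ℝ), ‖Sig n p‖ ≤ C * U) ∧
    (∀ (n : ℤ) (p p' : Fin 2 → ℝ), ‖Sig n p - Sig n p'‖ ≤ C * U * ‖p - p'‖) ∧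
    ∀ (n n' : ℤ) (p : Fin 2 → ℝ),
      ‖Sig n p - Sig n' p‖ ≤ C * U * |fermiMatsubara β n - fermiMatsubara β n'| ^ α

/-- **`IsFermiLiquidForm β U μ C α` — the Fermi-liquid FORM of the two-point function at inverse temperature `β`** (H1.i-b
of the cell's DECOMP §1): the momentum-space thermodynamic limit exists and there is a self-energy `Σ` obeying
`SelfEnergyBounds β U C α` such that for every fermionic frequency `k₀ = (2n+1)π/β`, momentum `p ∈ ℝ²` and spins,
`Ŝ_{σσ'}(k₀, p) = δ_{σσ'} · (i k₀ - e_μ(p) - Σ(k₀, p))⁻¹`.  A predicate; nothing is asserted.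
[cite: BenfattoGiulianiMastropietro2006, §1 (1.6)] -/
def IsFermiLiquidForm (β U μ C α : ℝ) : Prop :=
  HubbardTwoPointMomentumLimitExists β U μ ∧
    ∃ Sig : ℤ → (Fin 2 → ℝ) → ℂ, SelfEnergyBounds β U C α Sig ∧
      ∀ (n : ℤ) (p : Fin 2 → ℝ) (σ σ' : Fin 2),
        hubbardTwoPointHat β U μ n p σ σ' =
          (if σ = σ' then 1 else 0) *
            (((fermiMatsubara β n : ℝ) : ℂ) * Complex.I - ((freeBand μ p : ℝ) : ℂ) - Sig n p)⁻¹

/-! ### Bookkeeping lemmas -/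

/-- Junk value at `L = 0`. [folklore] -/
@[simp] theorem hubbardThermalTwoPointTime_zero_size (β U μ τ : ℝ) (x y : Site 2) (σ σ' : Fin 2) :
    hubbardThermalTwoPointTime β U μ 0 τ x y σ σ' = 0 := by
  simp [hubbardThermalTwoPointTime]

/-- At `τ = 0` the limit object is the tree's `htTwoPointLimit` on the spin diagonal. [folklore] -/
theorem hubbardTwoPointTimeLimit_zero (β U μ : ℝ) (z : Site 2) (σ : Fin 2) :
    hubbardTwoPointTimeLimit β U μ 0 z σ σ = htTwoPointLimit β U μ σ z := by
  unfold hubbardTwoPointTimeLimit htTwoPointLimit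
  simp_rw [hubbardThermalTwoPointTime_zero]

/-- Under convergence, the limit is the `limUnder` value. [folklore] -/
theorem tendsto_hubbardTwoPointTimeLimit {β U μ τ : ℝ} {z : Site 2} {σ σ' : Fin 2}
    (h : HubbardTwoPointTimeConverges β U μ τ z σ σ') :
    Tendsto (fun L : ℕ => hubbardThermalTwoPointTime β U μ L τ 0 z σ σ') atTop
      (𝓝 (hubbardTwoPointTimeLimit β U μ τ z σ σ')) := by
  obtain ⟨S, hS⟩ := h
  exact tendsto_nhds_limUnder ⟨S, hS⟩

/-- With the Fermi-liquid form and `Σ = 0`-bounds read at `U = 0`-size, the free function is the reference: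
`freeTwoPointHat β μ n p = (i k₀ - e_μ(p))⁻¹`. [folklore] -/
theorem freeTwoPointHat_eq (β μ : ℝ) (n : ℤ) (p : Fin 2 → ℝ) :
    freeTwoPointHat β μ n p = (((fermiMatsubara β n : ℝ) : ℂ) * Complex.I - ((freeBand μ p : ℝ) : ℂ) - 0)⁻¹ := by
  rw [freeTwoPointHat, sub_zero, one_div]

end Summit.HubbardSuperconductivity.HubbardSuperconductivity.Theorems.KLProgrammeTwoPoint

end
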